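import Summits.SmoothPoincare4.SmoothPoincare4.Theorems.EntropyRungBakryEmeryLogSobolev
import Summits.SmoothPoincare4.SmoothPoincare4.Theorems.EntropyRungBakryEmeryLogSobolevAPriori
import Summits.SmoothPoincare4.SmoothPoincare4.Theorems.EntropyRungBakryEmeryLogSobolevMass
import Summits.SmoothPoincare4.SmoothPoincare4.Theorems.EntropyRungBakryEmeryLogSobolevEntropyProduction
import Summits.SmoothPoincare4.SmoothPoincare4.Theorems.EntropyRungBakryEmeryLogSobolevFlowExistence
import Literature.Geometry.Riemannian.BakryEmeryLogSobolevReduction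
import Literature.Geometry.Riemannian.WeightedHeatFlowCompleteDecay
import Literature.Geometry.Riemannian.WeightedGreenComplete
import HarnessLib

/-!
# The Bakry–Émery logarithmic Sobolev inequality on a complete `CD(K,∞)` weighted manifold
# (closes support item `EntropyRung.BakryEmeryLogSobolev`, stmt-SmoothPoincare4-16587)

On a connected complete Riemannian manifold `(M, g)` modelled on `ℝⁿ` with `V` smooth,
`Ric_g + Hess V ≥ K g`, `K > 0`, `∫ e^{-V} dV_g = 1`:
`∫ φ e^φ e^{-V} ≤ (2K)⁻¹ ∫ |∇φ|² e^φ e^{-V}` for every smooth `φ` with `∫ e^φ e^{-V} = 1` (and the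
integrability provisos of the item). NO growth condition on `V` is assumed: the heat flow is the
energy-class flow of `EntropyRungBakryEmeryLogSobolevFlowExistence.lean` (ground-state transform with the
potential `¼|∇V|² − ½ΔV + 1`, perfect-square coercivity, Lions' very weak solutions, hypoellipticity),
and every step of the Bakry–Émery argument is run with FIRST-ORDER Gaffney cut-offs only
(`|∇η_k|² ≤ C₀/(k+1)²`; no bound on `Lη_k` exists in this generality):

* `logSobolev_eventuallyConst_gaffney` — the inequality for `φ` smooth and constant outside a compact
  set: with `f = e^φ = c + ψ`, `ψ ∈ C_c^∞`, the flow `u_T` on `[0, T]` from `f`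
  (`weightedHeatFlow_exists_gaffney`), `a ≤ u_T ≤ b` and `|∇u_T(s)|² ≤ e^{-2Ks} sup|∇f|²`
  (`gaffney_apriori`), unit mass (`gaffney_massConservation`),
  `H(f) − H(u_T(T)) ≤ I(f)/2K` (`gaffney_entropyProduction`), and `H(u_T(T)) → 0` as `T → ∞`
  (`tendsto_entropy_complete`, which only uses the slices `u_T(T)`).
* `bakryEmery_logSobolev_complete_holds` — the named fact `bakryEmery_logSobolev_complete`
  (density step `bakryEmery_logSobolev_complete_of_eventuallyConst`).
* `bakryEmeryLogSobolev_proof` — the route's support statement, by `bakryEmeryLogSobolev_of_fact`.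

## References

* [BakryGentilLedoux2014] D. Bakry, I. Gentil, M. Ledoux, *Analysis and Geometry of Markov Diffusion
  Operators* (2014), Thm. 5.2.1, Prop. 5.7.1, Cor. 5.7.2 (pp. 236–240, 268), §3.2 (pp. 141–148).
* [BakryEmery1985] D. Bakry, M. Émery, *Diffusions hypercontractives* (1985).
* [CarrilloNi2009] J. A. Carrillo, L. Ni, Comm. Anal. Geom. 17 (2009), Thm. 3.1 (p. 7).
* [Grigoryan2009] A. Grigor'yan, *Heat Kernel and Analysis on Manifolds* (2009), Ch. 7, §11.4, §12.1.
-/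

noncomputable section

set_option linter.dupNamespace false

open scoped Manifold ContDiff ENNReal NNReal Topology
open MeasureTheory Set Filter
open Literature.Geometry.Lorentzian Literature.Geometry.Riemannian

namespace Summit.SmoothPoincare4.SmoothPoincare4.Theorems.BakryEmeryComplete

open NoncompactShrinkerGapHeat NoncompactShrinkerGapHeat.CutoffToolkit

section Assembly

variable {n : ℕ} {M : Type} [TopologicalSpace M] [T2Space M] [SecondCountableTopology M]
  [ChartedSpace (EuclideanSpace ℝ (Fin n)) M] [IsManifold (𝓡 n) ∞ M] [ConnectedSpace M] [T3Space M]
  [MeasurableSpace M] [BorelSpace M]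
  {g : PseudoRiemannianMetric (𝓡 n) ∞ (EuclideanSpace ℝ (Fin n)) (TangentSpace (𝓡 n) : M → Type _)}
  [g.HasLeviCivita]

/-- **The logarithmic Sobolev inequality of a complete `CD(K,∞)` weighted manifold for smooth `φ`
constant outside a compact set** (Bakry–Émery along the energy-class heat flow with Gaffney cut-offs;
see the module docstring): `∫ φ e^φ e^{-V} ≤ (2K)⁻¹ ∫ |∇φ|² e^φ e^{-V}` when `∫ e^φ e^{-V} = 1 = ∫ e^{-V}`.
[cite: BakryGentilLedoux2014, Prop. 5.7.1 (p. 268), Thm. 5.2.1 (p. 238), §3.2 (pp. 141–148)]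
[cite: BakryEmery1985] [cite: CarrilloNi2009, Thm. 3.1 (p. 7)] -/
theorem logSobolev_eventuallyConst_gaffney (hg : g.IsRiemannian)
    (hc : ∀ (x : M) (r : NNReal), IsCompact {y : M | g.edist hg x y ≤ r})
    {V : M → ℝ} (hV : ContMDiff (𝓡 n) 𝓘(ℝ, ℝ) ∞ V) {K : ℝ} (hK : 0 < K)
    (hRic : ∀ (x : M) (X : TangentSpace (𝓡 n) x), K * g.val x X X ≤ g.ricci x X X + g.hessian V x X X)
    (hmass : ∫ x, Real.exp (-V x) ∂g.riemVolume = 1)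
    (φ : M → ℝ) (hφ : ContMDiff (𝓡 n) 𝓘(ℝ, ℝ) ∞ φ)
    (hφK : ∃ K₀ : Set M, IsCompact K₀ ∧ ∃ c : ℝ, ∀ x, x ∉ K₀ → φ x = c)
    (hφmass : ∫ x, Real.exp (φ x) * Real.exp (-V x) ∂g.riemVolume = 1) :
    ∫ x, φ x * (Real.exp (φ x) * Real.exp (-V x)) ∂g.riemVolume ≤
      1 / (2 * K) * ∫ x, g.gradSq φ x * (Real.exp (φ x) * Real.exp (-V x)) ∂g.riemVolume := by
  haveI : Nonempty M := ConnectedSpace.toNonempty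
  obtain ⟨o⟩ := ‹Nonempty M›
  haveI := CarrilloNi2009_shrinkerLSI.isFiniteMeasureOnCompacts_riemVolume hg
  set μ : Measure M := g.riemVolume with hμ
  obtain ⟨K₀, hK₀, cφ, hcφ⟩ := hφK
  have hw : Integrable (fun x ↦ Real.exp (-V x)) μ := by
    by_contra h'; rw [integral_undef h'] at hmass; exact zero_ne_one hmass
  have hexpc : Continuous fun y ↦ Real.exp (-V y) := Real.continuous_exp.comp hV.continuous.neg
  -- Gaffney cut-offs
  obtain ⟨η, C₀, hηs, hηc, hη01, hηmono, hη1, hηgrad⟩ := exists_gaffney_cutoff hg hc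
  /- the datum `f = e^φ`, its bounds `a ≤ f ≤ b`, the constant `c = e^{cφ}` at infinity -/
  set f : M → ℝ := fun x ↦ Real.exp (φ x) with hfdef
  have hf : ContMDiff (𝓡 n) 𝓘(ℝ, ℝ) ∞ f := Real.contDiff_exp.comp_contMDiff hφ
  obtain ⟨C₁, hC₁⟩ := exists_forall_abs_le_of_eventuallyConst hφ.continuous ⟨K₀, hK₀, cφ, hcφ⟩
  set Cφ : ℝ := max C₁ |cφ| with hCφdef
  have hCφ : ∀ x, |φ x| ≤ Cφ := fun x ↦ (hC₁ x).trans (le_max_left _ _)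
  have hcφC : |cφ| ≤ Cφ := le_max_right _ _
  set a : ℝ := Real.exp (-Cφ) with hadef
  set b : ℝ := Real.exp Cφ with hbdef
  set c : ℝ := Real.exp cφ with hcdef
  have ha : 0 < a := Real.exp_pos _
  have hfa : ∀ x, a ≤ f x := fun x ↦ Real.exp_le_exp.2 (neg_le_of_abs_le (hCφ x))
  have hfb : ∀ x, f x ≤ b := fun x ↦ Real.exp_le_exp.2 (le_of_abs_le (hCφ x))
  have hac : a ≤ c := Real.exp_le_exp.2 (neg_le_of_abs_le hcφC)
  have hcb : c ≤ b := Real.exp_le_exp.2 (le_of_abs_le hcφC)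
  -- `|∇f|² = f² |∇φ|² ≤ CΓf`
  have hΓφc : Continuous (g.gradSq φ) := (contMDiff_gradSq g hφ).continuous
  obtain ⟨CΓφ, hCΓφ⟩ := exists_forall_abs_le_of_eventuallyConst hΓφc ⟨K₀, hK₀, 0, fun x hx ↦
    g.gradSq_eq_zero_of_mvfderiv_eq_zero (mvfderiv_eq_zero_of_eventuallyConst hK₀ hcφ hx)⟩
  have hΓf : ∀ x, g.gradSq f x = f x ^ 2 * g.gradSq φ x := fun x ↦ by
    have hh : HasDerivAt Real.exp (Real.exp (φ x)) (φ x) := Real.hasDerivAt_exp _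
    exact g.gradSq_real_comp hh (hφ.mdifferentiableAt (by simp))
  set CΓf : ℝ := b ^ 2 * CΓφ with hCΓfdef
  have hΓfb : ∀ x, g.gradSq f x ≤ CΓf := fun x ↦ by
    rw [hΓf x]
    exact mul_le_mul (pow_le_pow_left₀ (Real.exp_pos _).le (hfb x) 2) ((le_abs_self _).trans (hCΓφ x))
      (g.gradSq_nonneg hg φ x) (sq_nonneg _)
  have hCΓf0 : 0 ≤ CΓf := (g.gradSq_nonneg hg f o).trans (hΓfb o)
  -- `ψ = f − c ∈ C_c^∞`
  set ψ : M → ℝ := fun x ↦ f x - c with hψdef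
  have hψ : ContMDiff (𝓡 n) 𝓘(ℝ, ℝ) ∞ ψ := hf.sub contMDiff_const
  have hψ0 : ∀ x, x ∉ K₀ → ψ x = 0 := fun x hx ↦ by simp only [hψdef, hfdef, hcφ x hx, hcdef, sub_self]
  have hψc : HasCompactSupport ψ := HasCompactSupport.intro hK₀ hψ0
  have h0int : Integrable (fun x ↦ ψ x ^ 2 * Real.exp (-V x)) μ := by
    have hsupp : HasCompactSupport (fun x ↦ ψ x ^ 2 * Real.exp (-V x)) := by
      refine HasCompactSupport.intro hK₀ fun x hx ↦ ?_
      rw [hψ0 x hx]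
      ring
    exact integrable_of_continuous_of_hasCompactSupport' hg ((hψ.continuous.pow 2).mul hexpc) hsupp
  -- entropy and Fisher information of `f`
  set Hf : ℝ := ∫ x, f x * Real.log (f x) * Real.exp (-V x) ∂μ with hHfdef
  set If : ℝ := ∫ x, g.gradSq f x / f x * Real.exp (-V x) ∂μ with hIfdef
  /- the flow with horizon `T`: a-priori bounds, mass, entropy production -/
  have hflow : ∀ T : ℝ, 0 < T → ∃ uT : M → ℝ, ContMDiff (𝓡 n) 𝓘(ℝ, ℝ) ∞ uT ∧
      (∀ x, a ≤ uT x ∧ uT x ≤ b) ∧ (∀ x, g.gradSq uT x ≤ Real.exp (-2 * K * T) * CΓf) ∧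
      ∫ x, uT x * Real.exp (-V x) ∂μ = 1 ∧
      Hf - ∫ x, uT x * Real.log (uT x) * Real.exp (-V x) ∂μ ≤ 1 / (2 * K) * If := by
    intro T hT
    obtain ⟨O, u, hO, hTO, hu, hu0, heq, hint⟩ :=
      weightedHeatFlow_exists_gaffney hg hV hηs hηc hη01 hηmono hη1 hηgrad c hψ hψc hT
    have hu0f : u 0 = f := funext fun x ↦ by rw [hu0 x]; simp only [hψdef]; ring
    have hTT : T ∈ Icc 0 T := ⟨hT.le, le_rfl⟩
    have h0ab : ∀ x, a ≤ u 0 x ∧ u 0 x ≤ b := fun x ↦ by rw [hu0f]; exact ⟨hfa x, hfb x⟩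
    have hG₀ : ∀ x, g.gradSq (u 0) x ≤ CΓf := fun x ↦ by rw [hu0f]; exact hΓfb x
    have h0 : Integrable (fun x ↦ (u 0 x - c) ^ 2 * Real.exp (-V x)) μ := by
      rw [hu0f]
      exact h0int
    obtain ⟨hab, hgrad⟩ := gaffney_apriori hg hV hRic hηs hηc hη01 hηmono hη1 hηgrad hT hO hTO hu heq
      hac hcb h0ab hG₀ hint h0
    have hgrad' : ∀ s ∈ Icc 0 T, ∀ x, g.gradSq (u s) x ≤ CΓf := fun s hs x ↦ by
      refine (hgrad s hs x).trans (mul_le_of_le_one_left hCΓf0 ?_)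
      exact Real.exp_le_one_iff.2 (by nlinarith [hs.1, hK])
    have hB : ∀ s ∈ Icc 0 T, ∀ x, |u s x| ≤ b := fun s hs x ↦ by
      rw [abs_of_nonneg (ha.le.trans (hab s hs x).1)]
      exact (hab s hs x).2
    have hmassT : ∫ x, u T x * Real.exp (-V x) ∂μ = 1 := by
      rw [gaffney_massConservation hg hV hw hηs hηc hη01 hη1 hηgrad hO hTO hu heq hB hgrad' hTT, hu0f]
      exact hφmass
    have hent := gaffney_entropyProduction hg hV hRic hK hw hηs hηc hη01 hη1 hηgrad hT hO hTO hu heq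
      ha hab hgrad'
    rw [hu0f] at hent
    exact ⟨u T, contMDiff_slice_of_contMDiffOn hu (hTO hTT), hab T hTT, hgrad T hTT, hmassT, hent⟩
  choose uT huTs huTab huTgrad huTmass huTent using hflow
  /- the slices `U t = u_t(t)` (`t > 0`), `U t = f` (`t ≤ 0`), and `H(U t) → 0` -/
  set U : ℝ → M → ℝ := fun t ↦ if ht : 0 < t then uT t ht else f with hUdef
  have hUpos : ∀ t (ht : 0 < t), U t = uT t ht := fun t ht ↦ by simp only [hUdef, dif_pos ht]
  have hUnp : ∀ t, ¬ 0 < t → U t = f := fun t ht ↦ by simp only [hUdef, dif_neg ht]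
  have huc : ∀ t ∈ Ici (0 : ℝ), ContMDiff (𝓡 n) 𝓘(ℝ, ℝ) 1 (U t) := by
    intro t _ht
    by_cases h : 0 < t
    · rw [hUpos t h]; exact (huTs t h).of_le (by norm_num)
    · rw [hUnp t h]; exact hf.of_le (by norm_num)
  have habU : ∀ t ∈ Ici (0 : ℝ), ∀ x, a ≤ U t x ∧ U t x ≤ b := by
    intro t _ht x
    by_cases h : 0 < t
    · rw [hUpos t h]; exact huTab t h x
    · rw [hUnp t h]; exact ⟨hfa x, hfb x⟩
  have hgradU : ∀ t ∈ Ici (0 : ℝ), ∀ x, g.gradSq (U t) x ≤ (Real.exp (-K * t)) ^ 2 * CΓf := by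
    intro t ht x
    have hexp : Real.exp (-K * t) ^ 2 = Real.exp (-2 * K * t) := by
      rw [sq, ← Real.exp_add]; ring_nf
    rw [hexp]
    by_cases h : 0 < t
    · rw [hUpos t h]; exact huTgrad t h x
    · rw [hUnp t h]
      have ht0 : t = 0 := le_antisymm (not_lt.1 h) ht
      rw [ht0, mul_zero, Real.exp_zero, one_mul]
      exact hΓfb x
  have hmassU : ∀ t ∈ Ici (0 : ℝ), ∫ x, U t x * Real.exp (-V x) ∂μ = 1 := by
    intro t _ht
    by_cases h : 0 < t
    · rw [hUpos t h]; exact huTmass t h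
    · rw [hUnp t h]; exact hφmass
  have hlim := tendsto_entropy_complete hg hV hw hmass huc ha habU hK hCΓf0 hgradU hmassU
  -- `H(f) − I(f)/2K ≤ H(U t)` for `t > 0`, hence `≤ 0`
  have hev : ∀ᶠ t in atTop, Hf - 1 / (2 * K) * If ≤ ∫ x, U t x * Real.log (U t x) * Real.exp (-V x) ∂μ := by
    filter_upwards [eventually_gt_atTop (0 : ℝ)] with t ht
    rw [hUpos t ht]
    linarith [huTent t ht]
  have hfin : Hf - 1 / (2 * K) * If ≤ 0 := ge_of_tendsto hlim hev
  /- identification of `H(f)` and `I(f)` -/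
  have hH0 : Hf = ∫ x, φ x * (Real.exp (φ x) * Real.exp (-V x)) ∂μ := by
    rw [hHfdef]
    refine integral_congr_ae (Eventually.of_forall fun x ↦ ?_)
    simp only [hfdef, Real.log_exp]
    ring
  have hI0 : If = ∫ x, g.gradSq φ x * (Real.exp (φ x) * Real.exp (-V x)) ∂μ := by
    rw [hIfdef]
    refine integral_congr_ae (Eventually.of_forall fun x ↦ ?_)
    dsimp only
    rw [hΓf x]
    simp only [hfdef]
    have hne : Real.exp (φ x) ≠ 0 := (Real.exp_pos _).ne'
    field_simp
  rw [hH0, hI0] at hfin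
  linarith

end Assembly

/-! ### The named fact and the route item -/

/-- **The named fact `bakryEmery_logSobolev_complete` holds**: the logarithmic Sobolev inequality
`LSI((2K)⁻¹)` of a complete `CD(K,∞)` weighted manifold, `K > 0`, for all smooth `φ` with
`∫ e^φ e^{-V} = 1` — by the density step `bakryEmery_logSobolev_complete_of_eventuallyConst` from
`logSobolev_eventuallyConst_gaffney`.
[cite: BakryGentilLedoux2014, Prop. 5.7.1 and Cor. 5.7.2 (p. 268)] [cite: CarrilloNi2009, Thm. 3.1 (p. 7)] -/
theorem bakryEmery_logSobolev_complete_holds : bakryEmery_logSobolev_complete := by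
  refine bakryEmery_logSobolev_complete_of_eventuallyConst ?_
  intro n M _ _ _ _ _ _ _ _ _ g _ V K hg hc hV hK hRic hmass φ hφ hφK hφmass
  have hc' : ∀ (x : M) (r : NNReal), IsCompact {y : M | g.edist hg x y ≤ r} := fun x r ↦ by
    simpa only [PseudoRiemannianMetric.riemEDist_eq hg] using hc x r
  exact logSobolev_eventuallyConst_gaffney hg hc' hV hK hRic hmass φ hφ hφK hφmass

/-- **The route's support item `EntropyRung.BakryEmeryLogSobolev`** (Carrillo–Ni 2009, Thm. 3.1 via
Bakry–Émery): proved unconditionally from `bakryEmery_logSobolev_complete_holds` through the bridge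
`bakryEmeryLogSobolev_of_fact`.
[cite: CarrilloNi2009, Thm. 3.1 (p. 7)] [cite: BakryGentilLedoux2014, Prop. 5.7.1 (p. 268)] -/
theorem bakryEmeryLogSobolev_proof :
    Summit.SmoothPoincare4.SmoothPoincare4.Theses.EntropyRung.BakryEmeryLogSobolev :=
  bakryEmeryLogSobolev_of_fact bakryEmery_logSobolev_complete_holds

end Summit.SmoothPoincare4.SmoothPoincare4.Theorems.BakryEmeryComplete

end
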